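import Summits.QuantumFields.BalabanUV.Beta.GAN24.LayerLetterFaces
import Summits.QuantumFields.BalabanUV.Beta.GAN24.WardResidualRotatedVertex
import Summits.QuantumFields.BalabanUV.Beta.GAN24.GaugeReadLayerForm

/-!
# `BalabanUV.Beta.GAN24.LayerLetterRotated` — binder row G-an2-4 ∕ (CONV-C), W-slot CT-W, route «WC-TL» ∕ (Q-R) «QR-LL», row (LAY), programme
# «(LAY-LIT) THE LITERAL's LETTER PROFILE ROWS `hS ∧ hω` OF THE (Q-R) END», PART 2:
# **THE ROTATED-VERTEX PIECE (α) SUMMED OVER THE LABELS OF A SUPER-BLOCK IS A FACE LETTER AT THE SLOT** — `dM G` on the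
# straddle-reweighted tables is `BiLoc` at `N•y′` with constant `C·FW_U^{δ∕2}(N•y′)` (G-an2-4 formalisation swarm → CRUX TEAM (2), leaf prover
# `b2b-balaban-gan24-formalise-leaf-03`, gen 61; INTENT 2, journal `CLAIMS.log`; names PROVISIONAL)

NOT IN PRINT; OUR BOOKKEEPING ([folklore] the `wsum ∕ cwsum` calculus (`OneStepResolventKernel.biLoc_wsum`, `InterLevelTransport.biLoc_cwsum`) over p2 g38's
closed form `WardResidualRotatedVertex.dM_conjV_diagK`, p2 g37's `WardResidualLabelSums.sum_rotated_vertex`, leaf-06 g44's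
`GaugeReadLayerForm.sum_sum_box_eq_sum_biUnion` and PART 1's weight lemma `LayerLetterFaces.indDiff_mul_exp_le_faceW` BY NAME; generic `d`, GENERIC
`G ∕ S ∕ M ∕ U` — no object of an2's typed system; 0 `def`, 0 cited facts, 0 `def … : Prop`, 0 sorry).  HONEST FRAMING (cell contract, verbatim):
«discharging `BetaPertH` makes Bałaban's UV stability UNCONDITIONAL — a real constructive-QFT result; it is NOT the continuum limit and NOT the Clay
problem.»  HONEST DEPENDENCY (verbatim): «continuum YM on T⁴ ⇐ BetaPertH ∧ nine spine estimates (0/9 proved); BetaPertH ⇐ (D1) ∧ (D4) ∧ CAP+tail;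
G-an2-4 gates asym, D1 and NE2/3/4.»

## What
The (α) piece of the explicit first-order data `Ψ_j(y; ν, y′)` of `WardResidualSUnrolled.exists_kernelLaws_unrolled` is `½ • dM (conjV G_j X_y) Lc S_j M1_j ν y′`,
`X_y = diagK (½ • Σ_{v∈box} legInd ρ (Lc•y + v))`.  Summed over the labels `y ∈ T` of a super-block it is the same object with the generator of the FINE UNION
`U = T.biUnion (y ↦ (box).image (v ↦ N•y + toSite v))` (`sum_rotated_vertex` ⨾ `sum_sum_box_eq_sum_biUnion`), and `dM_conjV_diagK` writes that as `dM G` on the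
tables reweighted by «`ξ·𝟙_U` of the SLOT leg minus `ξ·𝟙_U` of the TABLE leg» — field table: `(𝟙_U(N•y′+ρ)ξ − 𝟙_U(u)ξ) • S κ u`; multiplier table:
`(𝟙_U(N•y′+ρ)ξ − 𝟙_U(N•w+ρ)ξ) • M ρ′ w`.  THIS FILE bounds it, for `Decays G CG δ`, `LocStencil S Cs δ`, `VertexFamily M N Cm δ` (ONE rate; `0 < δ`); every
estimate comes in an ABSTRACT-WEIGHT form `…_of_faceBound` (any `W ≥ 0` dominating `e^{−(δ∕2)‖w−N•y′‖₁}` on the boundary layer of `U` — PART 6 plugs a multiple of the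
END's COARSE face sum) and in the FACE-SUM form (`W := FW_U^{δ∕2}(N•y′)` of PART 1):
* §1 `wsum_smul_family ∕ cwsum_smul_family` — a scalar reweighting of the family moves into the weights (pointwise, no summability).
* §2 **`biLoc_vertexOfK_straddle`** — the field half: `BiLoc (vertexOfK G N S′ ν y′) (N•y′) (N•y′) ((d+1)·(|ξ|·CG·e^{δ‖ρ‖₁}·FW^{δ∕2}(N•y′)·Cs·Zl(δ∕4))) (δ∕4)`
  (weights `colH G·(indicator difference)` bounded by PART 1's weight lemma — zero unless `u` and the slot leg straddle `∂U`; then `biLoc_wsum`).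
* §3 **`biLoc_vertexOfM_straddle`** — the multiplier half, the same with `Cm` (`colM G`, `biLoc_cwsum`).
* §4 **`biLoc_dM_straddle`**, **`biLoc_dM_conjV_blockGen`** — `BiLoc (dM (conjV G (diagK (ξ • Σ_{u∈U} legInd ρ u))) N S M ν y′) (N•y′) (N•y′)
  ((d+1)·|ξ|·CG·e^{δ‖ρ‖₁}·(Cs + Cm)·Zl(δ∕4)·FW_U^{δ∕2}(N•y′)) (δ∕4)` — ANY finite fine region `U`.
* §5 **`biLoc_sum_rotatedVertex`** — THE LITERAL SHAPE: `Σ_{y∈T} ½ • dM (conjV G (diagK (½ • Σ_{v∈box} legInd ρ (N•y + toSite v)))) N S M ν y′` is `BiLoc` at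
  `N•y′` with constant `¼·(d+1)·CG·e^{δ‖ρ‖₁}·(Cs + Cm)·Zl(δ∕4)·FW_U^{δ∕2}(N•y′)`, `U` the fine union of `T` — uniformly in `T` except through the face weight.
= the (α) third of PART 5's `Ψ_T`.  DISCHARGES NO ROW: the literal `G_j ∕ S_j ∕ M1_j` and their (level-free) classes enter only in PART 6; (LAY)'s literal rows,
(LT), K-LL-4, the (S) row, the END and (Q-R) are NOT here; 0 estimate of Bałaban's; NOTHING of (Q-R) ∕ (LT) ∕ (Q-L) ∕ (C) ∕ (S) ∕ «T2Shape» ∕ «T2Drift» ∕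
(hW, hWall) discharged; NEVER «G-an2-4 closed» as (CONV-C); NOT D1, NOT `BetaPertH`, NOT continuum, NOT Clay.  2026-08-22.
-/

noncomputable section

namespace Summit.QuantumFields.BalabanUV.Beta.GAN24.LayerLetterRotated

open Finset
open scoped BigOperators
open Literature.MathematicalPhysics.QuantumFieldTheory
open Literature.MathematicalPhysics.QuantumFieldTheory.Balaban1983to89
open Literature.MathematicalPhysics.QuantumFieldTheory.Balaban1983to89.Beta
open Literature.MathematicalPhysics.QuantumFieldTheory.Balaban1983to89.B12Sec2to5 (l1 l1_nonneg)
open B6BondElimination (unitVec)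
open ExpKernelCalculus (MKer Site BiLoc Decays VertexFamily comp Zl Zl_nonneg l1_sub_triangle)
open OneStepResolventKernel (Fib LocStencil wsum biLoc_wsum biLoc_finset_sum)
open OneStepKernelFamily (colH vertexOfK abs_colH_le)
open SecondOrderResponse (colM vertexOfM dM abs_colM_le)
open InterLevelTransport (cwsum cwsum_apply biLoc_cwsum)
open KernelWard (bdd_of_biLoc biLoc_add)
open StepJetData (biLoc_weaken)
open AffineAveraging (box toSite)
open Summit.QuantumFields.BalabanUV.Beta.ChartConjugation (conjV)
open Summit.QuantumFields.BalabanUV.Beta.ChartConjugationReflection (abs_le_of_locStencil)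
open Summit.QuantumFields.BalabanUV.Beta.BorderedHessian (diagK)
open Summit.QuantumFields.BalabanUV.Beta.AveragingWardRootedStencils (legSite legInd legSite_inl legSite_inr)
open Summit.QuantumFields.BalabanUV.Beta.WardLocusResidualClass (abs_blockGen_le)
open Summit.QuantumFields.BalabanUV.Beta.GAN24.LayerCommutatorSupport (smul_sum_legInd_apply)
open Summit.QuantumFields.BalabanUV.Beta.GAN24.LayerLetterFaces (faceW_nonneg exp_le_faceW_of_mem indDiff_mul_exp_le_of_faceBound)
open Summit.QuantumFields.BalabanUV.Beta.GAN24.WardResidualRotatedVertex (dM_conjV_diagK)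
open Summit.QuantumFields.BalabanUV.Beta.GAN24.WardResidualLabelSums (sum_rotated_vertex)
open Summit.QuantumFields.BalabanUV.Beta.GAN24.GaugeReadLayerForm (sum_sum_box_eq_sum_biUnion)

variable {d N : ℕ}

/-! ## §1 Scalar reweightings of a family move into the superposition weights -/

/-- [folklore] `wsum w (u ↦ c u • K u) = wsum (w·c) K` (pointwise). -/
theorem wsum_smul_family (w c : Site (d + 1) → ℝ) (K : Site (d + 1) → MKer (d + 1) (Fib d)) :
    wsum w (fun u => c u • K u) = wsum (fun u => w u * c u) K := by
  funext x z a b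
  simp only [OneStepResolventKernel.wsum, Pi.smul_apply, smul_eq_mul]
  exact tsum_congr fun u => by ring

/-- [folklore] `cwsum N w (y ↦ c y • Q y) = cwsum N (w·c) Q` (pointwise). -/
theorem cwsum_smul_family [NeZero N] (w c : Site (d + 1) → ℝ) (Q : Site (d + 1) → MKer (d + 1) (Fib d)) :
    cwsum N w (fun y => c y • Q y) = cwsum N (fun y => w y * c y) Q := by
  funext x z a b
  rw [cwsum_apply, cwsum_apply]
  simp only [Pi.smul_apply, smul_eq_mul]
  exact tsum_congr fun y => by ring

/-- [folklore] `‖(q + ρ) − q‖₁ = ‖ρ‖₁`. -/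
theorem l1_add_sub_self (q ρ : Site (d + 1)) : l1 (q + ρ - q) = l1 ρ := by
  rw [add_sub_cancel_left]

/-- [folklore] `‖u − u‖₁ = 0`. -/
theorem l1_sub_self (u : Site (d + 1)) : l1 (u - u) = 0 := by
  rw [sub_self]; unfold l1; simp

/-! ## §2 The field half: `vertexOfK G` of the straddle-reweighted stencil table -/

/-- [folklore] **THE FIELD HALF OF (α) IS A FACE LETTER (abstract weight).**  For `Decays G CG δ`, `LocStencil S Cs δ` (`0 < δ`), a finite fine region `U`,
root offset `ρ`, weight `ξ`, slot `(ν, y′)`, and any `W ≥ 0` dominating `e^{−(δ∕2)‖w−N•y′‖₁}` at every layer site `w` of `U`: the chain-rule vertex of the table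
`(𝟙_U(N•y′+ρ)ξ − 𝟙_U(u)ξ) • S κ u` is `BiLoc` at `N•y′`, rate `δ∕4`, constant `(d+1)·(|ξ|·CG·e^{δ‖ρ‖₁}·W·Cs·Zl(δ∕4))`.  Per `κ` the superposition weights are
`colH G N ν y′ κ u·(indicator difference)` (`wsum_smul_family`); `|colH| ≤ CG·e^{−δ‖u−N•y′‖₁}` (`abs_colH_le`) and PART 1's `indDiff_mul_exp_le_of_faceBound` (slot
leg `N•y′+ρ`, table leg `u`) make them `≤ |ξ|·CG·e^{(δ∕2)‖ρ‖₁}·W·e^{−(δ∕2)‖u−N•y′‖₁}`; then `biLoc_wsum` at rate `δ∕2`. -/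
theorem biLoc_vertexOfK_straddle_of_faceBound {G : MKer (d + 1) (Fib d)} {CG δ : ℝ} (hG : Decays G CG δ) (hδ : 0 < δ)
    {S : Fin (d + 1) → Site (d + 1) → MKer (d + 1) (Fib d)} {Cs : ℝ} (hS : LocStencil S Cs δ)
    (U : Finset (Site (d + 1))) (ρ : Site (d + 1)) (ξ : ℝ) (ν : Fin (d + 1)) (y' : Site (d + 1)) {W : ℝ} (hW0 : 0 ≤ W)
    (hW : ∀ μ w, (w ∈ U \ U.image (fun v => v - unitVec μ) ∨ w ∈ U.image (fun v => v - unitVec μ) \ U) →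
      Real.exp (-(δ / 2) * l1 (w - (N : ℤ) • y')) ≤ W) :
    BiLoc (vertexOfK G N (fun κ u => ((if (N : ℤ) • y' + ρ ∈ U then ξ else 0) - (if u ∈ U then ξ else 0)) • S κ u) ν y')
      ((N : ℤ) • y') ((N : ℤ) • y') (((d : ℝ) + 1) * (|ξ| * CG * Real.exp (δ * l1 ρ) * W * Cs * Zl (d + 1) (δ / 4))) (δ / 4) := by
  set q : Site (d + 1) := (N : ℤ) • y' with hq
  have hCG : 0 ≤ CG := hG.nonneg (Sum.inl 0)
  have hC0 : 0 ≤ |ξ| * CG * Real.exp (δ * l1 ρ) * W := by positivity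
  -- per direction `κ`: one superposition
  have hκ : ∀ κ : Fin (d + 1), BiLoc (wsum (colH G N ν y' κ)
      (fun u => ((if (N : ℤ) • y' + ρ ∈ U then ξ else 0) - (if u ∈ U then ξ else 0)) • S κ u)) q q
      (|ξ| * CG * Real.exp (δ * l1 ρ) * W * Cs * Zl (d + 1) (δ / 4)) (δ / 4) := by
    intro κ
    rw [wsum_smul_family]
    have hw : ∀ u, |colH G N ν y' κ u * ((if (N : ℤ) • y' + ρ ∈ U then ξ else 0) - (if u ∈ U then ξ else 0))|
        ≤ |ξ| * CG * Real.exp (δ * l1 ρ) * W * Real.exp (-(δ / 2) * l1 (u - q)) := by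
      intro u
      have h1 : |colH G N ν y' κ u| ≤ CG * Real.exp (-δ * l1 (u - q)) := abs_colH_le hG ν y' κ u
      have h2 := indDiff_mul_exp_le_of_faceBound U ξ hδ.le q ((N : ℤ) • y' + ρ) u u hW0 hW
      rw [← hq, l1_add_sub_self, l1_sub_self, add_zero] at h2
      have h3 : Real.exp (δ / 2 * l1 ρ) ≤ Real.exp (δ * l1 ρ) := by
        rw [Real.exp_le_exp]; nlinarith [l1_nonneg ρ]
      rw [abs_mul]
      calc |colH G N ν y' κ u| * |(if (N : ℤ) • y' + ρ ∈ U then ξ else 0) - (if u ∈ U then ξ else 0)|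
          ≤ CG * Real.exp (-δ * l1 (u - q)) * |(if (N : ℤ) • y' + ρ ∈ U then ξ else 0) - (if u ∈ U then ξ else 0)| :=
            mul_le_mul_of_nonneg_right h1 (abs_nonneg _)
        _ = CG * (|(if (N : ℤ) • y' + ρ ∈ U then ξ else 0) - (if u ∈ U then ξ else 0)| * Real.exp (-δ * l1 (u - q))) := by ring
        _ ≤ CG * (|ξ| * Real.exp (δ / 2 * l1 ρ) * W * Real.exp (-(δ / 2) * l1 (u - q))) := mul_le_mul_of_nonneg_left h2 hCG
        _ ≤ CG * (|ξ| * Real.exp (δ * l1 ρ) * W * Real.exp (-(δ / 2) * l1 (u - q))) := by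
            refine mul_le_mul_of_nonneg_left ?_ hCG
            exact mul_le_mul_of_nonneg_right (mul_le_mul_of_nonneg_right
              (mul_le_mul_of_nonneg_left h3 (abs_nonneg _)) hW0) (Real.exp_pos _).le
        _ = _ := by ring
    have hK : ∀ u, BiLoc (S κ u) u u Cs (δ / 2) := fun u => biLoc_weaken (hS κ u) le_rfl (by linarith)
    have h := biLoc_wsum hw hK (half_pos hδ) hC0
    have e : δ / 2 / 2 = δ / 4 := by ring
    rw [e] at h
    exact h
  -- sum over `κ`
  have hsum := biLoc_finset_sum (Finset.univ : Finset (Fin (d + 1))) (fun κ _ => hκ κ)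
  rw [Finset.sum_const, Finset.card_univ, Fintype.card_fin, nsmul_eq_mul] at hsum
  refine biLoc_weaken hsum (le_of_eq ?_) le_rfl
  push_cast
  ring

/-- [folklore] **THE FIELD HALF OF (α), FACE-SUM FORM** (`W :=` the face weight `FW_U^{δ∕2}(N•y′)` of PART 1). -/
theorem biLoc_vertexOfK_straddle {G : MKer (d + 1) (Fib d)} {CG δ : ℝ} (hG : Decays G CG δ) (hδ : 0 < δ)
    {S : Fin (d + 1) → Site (d + 1) → MKer (d + 1) (Fib d)} {Cs : ℝ} (hS : LocStencil S Cs δ)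
    (U : Finset (Site (d + 1))) (ρ : Site (d + 1)) (ξ : ℝ) (ν : Fin (d + 1)) (y' : Site (d + 1)) :
    BiLoc (vertexOfK G N (fun κ u => ((if (N : ℤ) • y' + ρ ∈ U then ξ else 0) - (if u ∈ U then ξ else 0)) • S κ u) ν y')
      ((N : ℤ) • y') ((N : ℤ) • y')
      (((d : ℝ) + 1) * (|ξ| * CG * Real.exp (δ * l1 ρ)
        * (∑ μ : Fin (d + 1),
          (∑ w' ∈ U.image (fun v => v - unitVec μ) \ U, Real.exp (-(δ / 2) * l1 (w' - (N : ℤ) • y'))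
            + ∑ w' ∈ U \ U.image (fun v => v - unitVec μ), Real.exp (-(δ / 2) * l1 (w' - (N : ℤ) • y'))))
        * Cs * Zl (d + 1) (δ / 4))) (δ / 4) :=
  biLoc_vertexOfK_straddle_of_faceBound hG hδ hS U ρ ξ ν y' (faceW_nonneg U (δ / 2) _)
    (fun _ _ hw => exp_le_faceW_of_mem U (δ / 2) _ hw)

/-! ## §3 The multiplier half: `vertexOfM G` of the straddle-reweighted multiplier table -/

/-- [folklore] **THE MULTIPLIER HALF OF (α) IS A FACE LETTER (abstract weight).**  For `Decays G CG δ`, `VertexFamily M N Cm δ` (`0 < δ`, `N ≥ 1`) and any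
`W ≥ 0` dominating `e^{−(δ∕2)‖w−N•y′‖₁}` on the layer of `U`: the multiplier-column vertex of the table `(𝟙_U(N•y′+ρ)ξ − 𝟙_U(N•w+ρ)ξ) • M ρ′ w` is `BiLoc` at
`N•y′`, rate `δ∕4`, constant `(d+1)·(|ξ|·CG·e^{δ‖ρ‖₁}·W·Cm·Zl(δ∕4))` (`abs_colM_le`, PART 1's weight lemma with slot leg `N•y′+ρ`, table leg `N•w+ρ` read at `N•w`,
`biLoc_cwsum`). -/
theorem biLoc_vertexOfM_straddle_of_faceBound [NeZero N] {G : MKer (d + 1) (Fib d)} {CG δ : ℝ} (hG : Decays G CG δ) (hδ : 0 < δ)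
    {M : Fin (d + 1) → Site (d + 1) → MKer (d + 1) (Fib d)} {Cm : ℝ} (hM : VertexFamily M N Cm δ)
    (U : Finset (Site (d + 1))) (ρ : Site (d + 1)) (ξ : ℝ) (ν : Fin (d + 1)) (y' : Site (d + 1)) {W : ℝ} (hW0 : 0 ≤ W)
    (hW : ∀ μ w, (w ∈ U \ U.image (fun v => v - unitVec μ) ∨ w ∈ U.image (fun v => v - unitVec μ) \ U) →
      Real.exp (-(δ / 2) * l1 (w - (N : ℤ) • y')) ≤ W) :
    BiLoc (vertexOfM G N (fun ρ' w => ((if (N : ℤ) • y' + ρ ∈ U then ξ else 0) - (if (N : ℤ) • w + ρ ∈ U then ξ else 0)) • M ρ' w) ν y')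
      ((N : ℤ) • y') ((N : ℤ) • y') (((d : ℝ) + 1) * (|ξ| * CG * Real.exp (δ * l1 ρ) * W * Cm * Zl (d + 1) (δ / 4))) (δ / 4) := by
  set q : Site (d + 1) := (N : ℤ) • y' with hq
  have hCG : 0 ≤ CG := hG.nonneg (Sum.inl 0)
  have hC0 : 0 ≤ |ξ| * CG * Real.exp (δ * l1 ρ) * W := by positivity
  have hρ' : ∀ ρ' : Fin (d + 1), BiLoc (cwsum N (colM G N ν y' ρ')
      (fun w => ((if (N : ℤ) • y' + ρ ∈ U then ξ else 0) - (if (N : ℤ) • w + ρ ∈ U then ξ else 0)) • M ρ' w)) q q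
      (|ξ| * CG * Real.exp (δ * l1 ρ) * W * Cm * Zl (d + 1) (δ / 4)) (δ / 4) := by
    intro ρ'
    rw [cwsum_smul_family]
    have hw : ∀ w, |colM G N ν y' ρ' w * ((if (N : ℤ) • y' + ρ ∈ U then ξ else 0) - (if (N : ℤ) • w + ρ ∈ U then ξ else 0))|
        ≤ |ξ| * CG * Real.exp (δ * l1 ρ) * W * Real.exp (-(δ / 2) * l1 ((N : ℤ) • w - q)) := by
      intro w
      have h1 : |colM G N ν y' ρ' w| ≤ CG * Real.exp (-δ * l1 ((N : ℤ) • w - q)) := abs_colM_le hG ν y' ρ' w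
      have h2 := indDiff_mul_exp_le_of_faceBound U ξ hδ.le q ((N : ℤ) • y' + ρ) ((N : ℤ) • w + ρ) ((N : ℤ) • w) hW0 hW
      rw [← hq, l1_add_sub_self, l1_add_sub_self] at h2
      have h3 : Real.exp (δ / 2 * (l1 ρ + l1 ρ)) = Real.exp (δ * l1 ρ) := by congr 1; ring
      rw [h3] at h2
      rw [abs_mul]
      calc |colM G N ν y' ρ' w| * |(if (N : ℤ) • y' + ρ ∈ U then ξ else 0) - (if (N : ℤ) • w + ρ ∈ U then ξ else 0)|
          ≤ CG * Real.exp (-δ * l1 ((N : ℤ) • w - q))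
              * |(if (N : ℤ) • y' + ρ ∈ U then ξ else 0) - (if (N : ℤ) • w + ρ ∈ U then ξ else 0)| :=
            mul_le_mul_of_nonneg_right h1 (abs_nonneg _)
        _ = CG * (|(if (N : ℤ) • y' + ρ ∈ U then ξ else 0) - (if (N : ℤ) • w + ρ ∈ U then ξ else 0)|
              * Real.exp (-δ * l1 ((N : ℤ) • w - q))) := by ring
        _ ≤ CG * (|ξ| * Real.exp (δ * l1 ρ) * W * Real.exp (-(δ / 2) * l1 ((N : ℤ) • w - q))) := mul_le_mul_of_nonneg_left h2 hCG
        _ = _ := by ring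
    have hK : ∀ w, BiLoc (M ρ' w) ((N : ℤ) • w) ((N : ℤ) • w) Cm (δ / 2) := fun w => biLoc_weaken (hM ρ' w) le_rfl (by linarith)
    have h := biLoc_cwsum hw hK (half_pos hδ) hC0
    have e : δ / 2 / 2 = δ / 4 := by ring
    rw [e] at h
    exact h
  have hsum := biLoc_finset_sum (Finset.univ : Finset (Fin (d + 1))) (fun ρ' _ => hρ' ρ')
  rw [Finset.sum_const, Finset.card_univ, Fintype.card_fin, nsmul_eq_mul] at hsum
  refine biLoc_weaken hsum (le_of_eq ?_) le_rfl
  push_cast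
  ring

/-- [folklore] **THE MULTIPLIER HALF OF (α), FACE-SUM FORM** (`W :=` the face weight `FW_U^{δ∕2}(N•y′)`). -/
theorem biLoc_vertexOfM_straddle [NeZero N] {G : MKer (d + 1) (Fib d)} {CG δ : ℝ} (hG : Decays G CG δ) (hδ : 0 < δ)
    {M : Fin (d + 1) → Site (d + 1) → MKer (d + 1) (Fib d)} {Cm : ℝ} (hM : VertexFamily M N Cm δ)
    (U : Finset (Site (d + 1))) (ρ : Site (d + 1)) (ξ : ℝ) (ν : Fin (d + 1)) (y' : Site (d + 1)) :
    BiLoc (vertexOfM G N (fun ρ' w => ((if (N : ℤ) • y' + ρ ∈ U then ξ else 0) - (if (N : ℤ) • w + ρ ∈ U then ξ else 0)) • M ρ' w) ν y')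
      ((N : ℤ) • y') ((N : ℤ) • y')
      (((d : ℝ) + 1) * (|ξ| * CG * Real.exp (δ * l1 ρ)
        * (∑ μ : Fin (d + 1),
          (∑ w' ∈ U.image (fun v => v - unitVec μ) \ U, Real.exp (-(δ / 2) * l1 (w' - (N : ℤ) • y'))
            + ∑ w' ∈ U \ U.image (fun v => v - unitVec μ), Real.exp (-(δ / 2) * l1 (w' - (N : ℤ) • y'))))
        * Cm * Zl (d + 1) (δ / 4))) (δ / 4) :=
  biLoc_vertexOfM_straddle_of_faceBound hG hδ hM U ρ ξ ν y' (faceW_nonneg U (δ / 2) _)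
    (fun _ _ hw => exp_le_faceW_of_mem U (δ / 2) _ hw)

/-! ## §4 The whole piece: `dM` of the straddle-reweighted tables = `dM` of the commutator with the union's generator -/

/-- [folklore] **`dM G` ON THE STRADDLE-REWEIGHTED TABLES IS A FACE LETTER (abstract weight)** (§2 + §3, `dM = vertexOfK + vertexOfM`): constant
`(d+1)·|ξ|·CG·e^{δ‖ρ‖₁}·(Cs + Cm)·Zl(δ∕4)·W`, rate `δ∕4`. -/
theorem biLoc_dM_straddle_of_faceBound [NeZero N] {G : MKer (d + 1) (Fib d)} {CG δ : ℝ} (hG : Decays G CG δ) (hδ : 0 < δ)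
    {S : Fin (d + 1) → Site (d + 1) → MKer (d + 1) (Fib d)} {Cs : ℝ} (hS : LocStencil S Cs δ)
    {M : Fin (d + 1) → Site (d + 1) → MKer (d + 1) (Fib d)} {Cm : ℝ} (hM : VertexFamily M N Cm δ)
    (U : Finset (Site (d + 1))) (ρ : Site (d + 1)) (ξ : ℝ) (ν : Fin (d + 1)) (y' : Site (d + 1)) {W : ℝ} (hW0 : 0 ≤ W)
    (hW : ∀ μ w, (w ∈ U \ U.image (fun v => v - unitVec μ) ∨ w ∈ U.image (fun v => v - unitVec μ) \ U) →
      Real.exp (-(δ / 2) * l1 (w - (N : ℤ) • y')) ≤ W) :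
    BiLoc (dM G N (fun κ u => ((if (N : ℤ) • y' + ρ ∈ U then ξ else 0) - (if u ∈ U then ξ else 0)) • S κ u)
        (fun ρ' w => ((if (N : ℤ) • y' + ρ ∈ U then ξ else 0) - (if (N : ℤ) • w + ρ ∈ U then ξ else 0)) • M ρ' w) ν y')
      ((N : ℤ) • y') ((N : ℤ) • y')
      (((d : ℝ) + 1) * |ξ| * CG * Real.exp (δ * l1 ρ) * (Cs + Cm) * Zl (d + 1) (δ / 4) * W) (δ / 4) := by
  have hK := biLoc_vertexOfK_straddle_of_faceBound (N := N) hG hδ hS U ρ ξ ν y' hW0 hW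
  have hMv := biLoc_vertexOfM_straddle_of_faceBound hG hδ hM U ρ ξ ν y' hW0 hW
  have h := biLoc_add hK hMv
  refine biLoc_weaken h (le_of_eq ?_) le_rfl
  ring

/-- [folklore] **(α) WITH THE UNION's GENERATOR IS A FACE LETTER (abstract weight).**  For any finite fine region `U`:
`dM (conjV G (diagK (ξ • Σ_{u∈U} legInd ρ u))) N S M ν y′` — p2's `dM_conjV_diagK` makes it `dM G` on the tables reweighted by the symbol at the slot leg minus the
symbol at the table leg; on a field leg the symbol `ξ • Σ_{u∈U} legInd ρ u` reads `ξ·𝟙_U(u)`, on a multiplier leg at `z` it reads `ξ·𝟙_U(z+ρ)`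
(`smul_sum_legInd_apply`, `legSite_inl ∕ _inr`) — is `BiLoc` at `N•y′` with constant `(d+1)·|ξ|·CG·e^{δ‖ρ‖₁}·(Cs + Cm)·Zl(δ∕4)·W`, rate `δ∕4`, for any `W ≥ 0`
dominating `e^{−(δ∕2)‖w−N•y′‖₁}` on the boundary layer of `U`. -/
theorem biLoc_dM_conjV_blockGen_of_faceBound [NeZero N] {G : MKer (d + 1) (Fib d)} {CG δ : ℝ} (hG : Decays G CG δ) (hδ : 0 < δ)
    {S : Fin (d + 1) → Site (d + 1) → MKer (d + 1) (Fib d)} {Cs : ℝ} (hS : LocStencil S Cs δ)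
    {M : Fin (d + 1) → Site (d + 1) → MKer (d + 1) (Fib d)} {Cm : ℝ} (hM : VertexFamily M N Cm δ)
    (U : Finset (Site (d + 1))) (ρ : Site (d + 1)) (ξ : ℝ) (ν : Fin (d + 1)) (y' : Site (d + 1)) {W : ℝ} (hW0 : 0 ≤ W)
    (hW : ∀ μ w, (w ∈ U \ U.image (fun v => v - unitVec μ) ∨ w ∈ U.image (fun v => v - unitVec μ) \ U) →
      Real.exp (-(δ / 2) * l1 (w - (N : ℤ) • y')) ≤ W) :
    BiLoc (dM (conjV G (diagK (ξ • ∑ u ∈ U, legInd ρ u))) N S M ν y') ((N : ℤ) • y') ((N : ℤ) • y')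
      (((d : ℝ) + 1) * |ξ| * CG * Real.exp (δ * l1 ρ) * (Cs + Cm) * Zl (d + 1) (δ / 4) * W) (δ / 4) := by
  rw [dM_conjV_diagK]
  simp only [smul_sum_legInd_apply, legSite_inl, legSite_inr]
  exact biLoc_dM_straddle_of_faceBound hG hδ hS hM U ρ ξ ν y' hW0 hW

/-- [folklore] **(α) WITH THE UNION's GENERATOR, FACE-SUM FORM**: `BiLoc (dM (conjV G (diagK (ξ • Σ_{u∈U} legInd ρ u))) N S M ν y′) (N•y′) (N•y′)
((d+1)·|ξ|·CG·e^{δ‖ρ‖₁}·(Cs + Cm)·Zl(δ∕4)·FW_U^{δ∕2}(N•y′)) (δ∕4)`. -/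
theorem biLoc_dM_conjV_blockGen [NeZero N] {G : MKer (d + 1) (Fib d)} {CG δ : ℝ} (hG : Decays G CG δ) (hδ : 0 < δ)
    {S : Fin (d + 1) → Site (d + 1) → MKer (d + 1) (Fib d)} {Cs : ℝ} (hS : LocStencil S Cs δ)
    {M : Fin (d + 1) → Site (d + 1) → MKer (d + 1) (Fib d)} {Cm : ℝ} (hM : VertexFamily M N Cm δ)
    (U : Finset (Site (d + 1))) (ρ : Site (d + 1)) (ξ : ℝ) (ν : Fin (d + 1)) (y' : Site (d + 1)) :
    BiLoc (dM (conjV G (diagK (ξ • ∑ u ∈ U, legInd ρ u))) N S M ν y') ((N : ℤ) • y') ((N : ℤ) • y')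
      (((d : ℝ) + 1) * |ξ| * CG * Real.exp (δ * l1 ρ) * (Cs + Cm) * Zl (d + 1) (δ / 4)
        * (∑ μ : Fin (d + 1),
          (∑ w' ∈ U.image (fun v => v - unitVec μ) \ U, Real.exp (-(δ / 2) * l1 (w' - (N : ℤ) • y'))
            + ∑ w' ∈ U \ U.image (fun v => v - unitVec μ), Real.exp (-(δ / 2) * l1 (w' - (N : ℤ) • y'))))) (δ / 4) :=
  biLoc_dM_conjV_blockGen_of_faceBound hG hδ hS hM U ρ ξ ν y' (faceW_nonneg U (δ / 2) _)
    (fun _ _ hw => exp_le_faceW_of_mem U (δ / 2) _ hw)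

/-! ## §5 The literal shape: the label sum of the rotated vertices of a super-block -/

/-- [folklore] **THE ROTATED-VERTEX PIECE (α) SUMMED OVER THE LABELS OF A SUPER-BLOCK IS A FACE LETTER AT THE SLOT (abstract weight).**  For
`Decays G CG δ`, `LocStencil S Cs δ`, `VertexFamily M N Cm δ` (`0 < δ`, `N ≥ 1`), a root offset `ρ`, ANY finset `T` of labels with fine union
`U = T.biUnion (y ↦ (box).image (v ↦ N•y + toSite v))`, every slot `(ν, y′)`, and any `W ≥ 0` dominating `e^{−(δ∕2)‖w−N•y′‖₁}` on the boundary layer of `U`: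
`Σ_{y∈T} ½ • dM (conjV G (diagK (½ • Σ_{v∈box} legInd ρ (N•y + toSite v)))) N S M ν y′` — the (α) piece of `Ψ(y; ν, y′)`
(`WardResidualSUnrolled.exists_kernelLaws_unrolled`'s `hΨ`, middle term) summed over the super-block — is
`BiLoc … (N•y′) (N•y′) (¼·(d+1)·CG·e^{δ‖ρ‖₁}·(Cs + Cm)·Zl(δ∕4)·W) (δ∕4)` (p2's `sum_rotated_vertex` ⨾ leaf-06's `sum_sum_box_eq_sum_biUnion` ⨾ §4 with `ξ = ½`).
PART 6 takes `W :=` (a multiple of) the END's COARSE face sum. -/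
theorem biLoc_sum_rotatedVertex_of_faceBound [NeZero N] {G : MKer (d + 1) (Fib d)} {CG δ : ℝ} (hG : Decays G CG δ) (hδ : 0 < δ)
    {S : Fin (d + 1) → Site (d + 1) → MKer (d + 1) (Fib d)} {Cs : ℝ} (hS : LocStencil S Cs δ)
    {M : Fin (d + 1) → Site (d + 1) → MKer (d + 1) (Fib d)} {Cm : ℝ} (hM : VertexFamily M N Cm δ)
    (ρ : Site (d + 1)) (T : Finset (Site (d + 1))) (ν : Fin (d + 1)) (y' : Site (d + 1)) {W : ℝ} (hW0 : 0 ≤ W)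
    (hW : ∀ μ w, (w ∈ T.biUnion (fun y => (box (d + 1) N).image (fun v => (N : ℤ) • y + toSite v))
                    \ (T.biUnion (fun y => (box (d + 1) N).image (fun v => (N : ℤ) • y + toSite v))).image (fun v => v - unitVec μ)
              ∨ w ∈ (T.biUnion (fun y => (box (d + 1) N).image (fun v => (N : ℤ) • y + toSite v))).image (fun v => v - unitVec μ)
                    \ T.biUnion (fun y => (box (d + 1) N).image (fun v => (N : ℤ) • y + toSite v))) →
      Real.exp (-(δ / 2) * l1 (w - (N : ℤ) • y')) ≤ W) :
    BiLoc (∑ y ∈ T, (1 / 2 : ℝ) • dM (conjV G (diagK (((1 : ℝ) / 2) • ∑ v ∈ box (d + 1) N, legInd ρ ((N : ℤ) • y + toSite v)))) N S M ν y')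
      ((N : ℤ) • y') ((N : ℤ) • y')
      ((1 / 4 : ℝ) * (((d : ℝ) + 1) * CG * Real.exp (δ * l1 ρ) * (Cs + Cm) * Zl (d + 1) (δ / 4)) * W) (δ / 4) := by
  -- bounded tables and symbols for the label-sum identity
  have hSb : ∀ κ u x z a b, |S κ u x z a b| ≤ Cs := fun κ u x z a b => abs_le_of_locStencil hS hδ.le κ u x z a b
  have hMb : ∀ ρ' w x z a b, |M ρ' w x z a b| ≤ Cm := fun ρ' w x z a b => bdd_of_biLoc (hM ρ' w) hδ.le x z a b
  have hg : ∀ (y z : Site (d + 1)) (b : Fib d), |(((1 : ℝ) / 2) • ∑ v ∈ box (d + 1) N, legInd ρ ((N : ℤ) • y + toSite v)) z b|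
      ≤ |(1 : ℝ) / 2| * (box (d + 1) N).card := fun y z b => abs_blockGen_le N ρ _ y z b
  rw [← Finset.smul_sum, sum_rotated_vertex T hG hδ N hg hSb hMb ν y']
  -- the summed symbol is the union's generator
  have hU : ∑ y ∈ T, ((1 : ℝ) / 2) • ∑ v ∈ box (d + 1) N, legInd ρ ((N : ℤ) • y + toSite v)
      = ((1 : ℝ) / 2) • ∑ u ∈ T.biUnion (fun y => (box (d + 1) N).image (fun v => (N : ℤ) • y + toSite v)), legInd ρ u := by
    rw [← Finset.smul_sum, sum_sum_box_eq_sum_biUnion (N := N) T (legInd ρ)]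
  rw [hU]
  have h := biLoc_dM_conjV_blockGen_of_faceBound hG hδ hS hM
    (T.biUnion (fun y => (box (d + 1) N).image (fun v => (N : ℤ) • y + toSite v))) ρ ((1 : ℝ) / 2) ν y' hW0 hW
  intro x z a b
  rw [Pi.smul_apply, Pi.smul_apply, Pi.smul_apply, Pi.smul_apply, smul_eq_mul, abs_mul]
  refine (mul_le_mul_of_nonneg_left (h x z a b) (abs_nonneg _)).trans (le_of_eq ?_)
  rw [abs_of_pos (by norm_num : (0 : ℝ) < 1 / 2)]
  ring

/-- [folklore] **THE ROTATED-VERTEX PIECE (α) SUMMED OVER THE LABELS OF A SUPER-BLOCK, FACE-SUM FORM** (`W := FW_U^{δ∕2}(N•y′)`, `U` the fine union of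
`T`): constant `¼·(d+1)·CG·e^{δ‖ρ‖₁}·(Cs + Cm)·Zl(δ∕4)·FW_U^{δ∕2}(N•y′)`, rate `δ∕4` — supported near the boundary layer of the fine union, UNIFORMLY IN `T` except
through the face weight. -/
theorem biLoc_sum_rotatedVertex [NeZero N] {G : MKer (d + 1) (Fib d)} {CG δ : ℝ} (hG : Decays G CG δ) (hδ : 0 < δ)
    {S : Fin (d + 1) → Site (d + 1) → MKer (d + 1) (Fib d)} {Cs : ℝ} (hS : LocStencil S Cs δ)
    {M : Fin (d + 1) → Site (d + 1) → MKer (d + 1) (Fib d)} {Cm : ℝ} (hM : VertexFamily M N Cm δ)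
    (ρ : Site (d + 1)) (T : Finset (Site (d + 1))) (ν : Fin (d + 1)) (y' : Site (d + 1)) :
    BiLoc (∑ y ∈ T, (1 / 2 : ℝ) • dM (conjV G (diagK (((1 : ℝ) / 2) • ∑ v ∈ box (d + 1) N, legInd ρ ((N : ℤ) • y + toSite v)))) N S M ν y')
      ((N : ℤ) • y') ((N : ℤ) • y')
      ((1 / 4 : ℝ) * (((d : ℝ) + 1) * CG * Real.exp (δ * l1 ρ) * (Cs + Cm) * Zl (d + 1) (δ / 4))
        * ∑ μ : Fin (d + 1),
          (∑ w' ∈ (T.biUnion (fun y => (box (d + 1) N).image (fun v => (N : ℤ) • y + toSite v))).image (fun v => v - unitVec μ)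
                \ T.biUnion (fun y => (box (d + 1) N).image (fun v => (N : ℤ) • y + toSite v)), Real.exp (-(δ / 2) * l1 (w' - (N : ℤ) • y'))
            + ∑ w' ∈ T.biUnion (fun y => (box (d + 1) N).image (fun v => (N : ℤ) • y + toSite v))
                \ (T.biUnion (fun y => (box (d + 1) N).image (fun v => (N : ℤ) • y + toSite v))).image (fun v => v - unitVec μ),
                  Real.exp (-(δ / 2) * l1 (w' - (N : ℤ) • y')))) (δ / 4) :=
  biLoc_sum_rotatedVertex_of_faceBound hG hδ hS hM ρ T ν y' (faceW_nonneg _ (δ / 2) _)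
    (fun _ _ hw => exp_le_faceW_of_mem _ (δ / 2) _ hw)

end Summit.QuantumFields.BalabanUV.Beta.GAN24.LayerLetterRotated

end
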